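import Summits.ValiantsHypothesis.ValiantsHypothesis.Theorems.BarrierLeverAnchoredDoorHitsLowerPairsSplitFamily
import Summits.ValiantsHypothesis.ValiantsHypothesis.Theorems.BarrierLeverAnchoredDoorHitsLowerPairsPadding

/-!
# Support item `AnchoredDoorHitsLowerPairs` (stmt-ValiantsHypothesis-22510), line `anchored-peeling`:
# CONJECTURE SP HOLDS FOR `m ≤ 2` — the registered stub `stub_splitFamily` on its first two levels, for EVERY ambient `h` and EVERY enumeration

Helper file (`--supports stmt-ValiantsHypothesis-22510`; cell valiant-natproofs, rung V4, 𝒟-side door (c); registered line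
`Cruxes/AnchoredDoorHitsLowerPairs/Lines/anchored_peeling.lean` v23 (registered stub `stub_splitFamily` = CONJECTURE SP, `…SplitFamily` p655274); prover seat
val-np-p1 gen 23). Definition-free. Closes NO item (PARTIAL RANGE: `m ∈ {1, 2}` of `∀ m ≥ 1`).

WHAT. The `decide` instances `Split1.symbolicDet_one_ne_zero` (`h = 5`, `r = 16`) and `Split2.symbolicDet_one_ne_zero` (`h = 11`, `r = 64`) of `…SplitFamily` are
LIFTED by `symbolicDet_ne_zero_lift` (`…Padding`, p655748: embedding invariance + re-enumeration invariance) to the literal text of `Stmt.stub_splitFamily` at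
`m = 1` and `m = 2`: for EVERY `h` above the stated bounds and EVERY pair of injective enumerations of `(SplitRow m h, SplitCol m h)` the profile-1 symbolic
minor is nonzero (`splitFamily_one`, `splitFamily_two`, `splitFamily_le_two`). The bridge between the bitmask tables and the range predicates is a finite
check by `decide` (`Split2.cols_complete`: every bitmask `< 2^11` with at most two bits and at most one bit `≥ 8` occurs in `Split2.cols`, etc.) plus the
generic coding lemmas `eq_map_ofBits_enc` / `mem_map_ofBits_iff`.

WHAT THIS IS NOT: SP for `m ≥ 3` is OPEN (LT-SAT search for `m = 3` running, kit j314726); nothing on crux stmt-ValiantsHypothesis-14610 or on `VP` versus `VNP`.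
-/

set_option linter.dupNamespace false

namespace Summit.ValiantsHypothesis.ValiantsHypothesis.Theorems.BarrierLever.AnchoredPeeling

open Finset

/-! ## 1. Coding faces below `h₀` by bitmasks, lifted along `Fin.castLEEmb` -/

section Coding

variable {h₀ h : ℕ}

/-- Membership in a lifted `ofBits`. -/
theorem mem_map_ofBits_iff (hle : h₀ ≤ h) (n : ℕ) (y : Fin h) :
    y ∈ (ofBits h₀ n).map (Fin.castLEEmb hle) ↔ y.val < h₀ ∧ n.testBit y.val = true := by
  rw [Finset.mem_map]
  constructor
  · rintro ⟨b, hb, rfl⟩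
    rw [mem_ofBits] at hb
    exact ⟨by simp [Fin.castLEEmb_apply], by simpa [Fin.castLEEmb_apply] using hb⟩
  · rintro ⟨hy, hbit⟩
    refine ⟨⟨y.val, hy⟩, mem_ofBits.mpr hbit, Fin.ext (by simp [Fin.castLEEmb_apply])⟩

/-- The code of a face with all values `< h₀` is `< 2^{h₀}`. -/
theorem enc_image_val_lt (U : Finset (Fin h)) (hU : ∀ y ∈ U, y.val < h₀) : DecFamily.enc (U.image Fin.val) < 2 ^ h₀ :=
  DecFamily.enc_lt_two_pow (fun v hv => by
    obtain ⟨y, hy, rfl⟩ := Finset.mem_image.mp hv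
    exact Finset.mem_range.mpr (hU y hy))

/-- **A face with all values `< h₀` is the lift of the `ofBits h₀` of its code.** -/
theorem eq_map_ofBits_enc (hle : h₀ ≤ h) (U : Finset (Fin h)) (hU : ∀ y ∈ U, y.val < h₀) :
    U = (ofBits h₀ (DecFamily.enc (U.image Fin.val))).map (Fin.castLEEmb hle) := by
  ext y
  rw [mem_map_ofBits_iff, ← DecFamily.mem_bits, DecFamily.bits_enc, Finset.mem_image]
  constructor
  · intro hy; exact ⟨hU y hy, y, hy, rfl⟩
  · rintro ⟨_, y', hy', hyy⟩; rw [← Fin.ext hyy]; exact hy'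

/-- The lifted `ofBits` of a code below `2^{h₀}` codes back to it. -/
theorem enc_image_val_map_ofBits (hle : h₀ ≤ h) {n : ℕ} (hn : n < 2 ^ h₀) :
    DecFamily.enc (((ofBits h₀ n).map (Fin.castLEEmb hle)).image Fin.val) = n := by
  have : ((ofBits h₀ n).map (Fin.castLEEmb hle)).image Fin.val = DecFamily.bits n := by
    ext v
    rw [Finset.mem_image, DecFamily.mem_bits]
    constructor
    · rintro ⟨y, hy, rfl⟩; exact ((mem_map_ofBits_iff hle n y).mp hy).2
    · intro hv
      have hvh : v < h₀ := by
        by_contra hge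
        rw [Nat.testBit_lt_two_pow (lt_of_lt_of_le hn (Nat.pow_le_pow_right (by norm_num) (not_lt.mp hge)))] at hv
        exact Bool.false_ne_true hv
      exact ⟨⟨v, by omega⟩, (mem_map_ofBits_iff hle n _).mpr ⟨hvh, hv⟩, rfl⟩
  rw [this, DecFamily.enc_bits]

end Coding

/-! ## 2. `m = 2`: the bitmask tables of `Split2` enumerate `SplitRow 2` and `SplitCol 2` -/

/-- The row table of `Split2` is the identity. -/
theorem Split2.rows_eq : ∀ i : Fin 64, Split2.rows i = i.val := by decide +kernel

/-- Every column bitmask of `Split2` has at most two bits, all `< 11`, at most one of them `≥ 8`. -/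
theorem Split2.cols_shape : ∀ j : Fin 64, Split2.cols j < 2 ^ 11 ∧ (ofBits 11 (Split2.cols j)).card ≤ 2 ∧
    (∀ v v' : Fin 11, (Split2.cols j).testBit v.val = true → (Split2.cols j).testBit v'.val = true → 8 ≤ v.val → 8 ≤ v'.val → v = v') := by
  decide +kernel

/-- Completeness of the column table of `Split2`: every admissible bitmask occurs. -/
theorem Split2.cols_complete : ∀ c : Fin 2048, (ofBits 11 c.val).card ≤ 2 →
    (∀ v v' : Fin 11, c.val.testBit v.val = true → c.val.testBit v'.val = true → 8 ≤ v.val → 8 ≤ v'.val → v = v') →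
    ∃ j : Fin 64, Split2.cols j = c.val := by
  decide +kernel

/-- The column table of `Split2` is injective. -/
theorem Split2.cols_injective : ∀ j j' : Fin 64, Split2.cols j = Split2.cols j' → j = j' := by decide +kernel

/-- **SP at `m = 2`, lifted: every enumeration of `(SplitRow 2 h, SplitCol 2 h)`, `h ≥ 11`, has nonzero profile-1 symbolic minor.** -/
theorem splitFamily_two (h r : ℕ) (u w : Fin r → Finset (Fin h)) (hh : 11 ≤ h) (hu : Function.Injective u) (hw : Function.Injective w)
    (hU : ∀ U : Finset (Fin h), U ∈ Set.range u ↔ SplitRow 2 h U) (hW : ∀ W : Finset (Fin h), W ∈ Set.range w ↔ SplitCol 2 h W) :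
    symbolicDet 1 h r u w ≠ 0 := by
  set ι := Fin.castLEEmb hh with hι
  refine symbolicDet_ne_zero_lift ι (fun i => ofBits 11 (Split2.rows i)) (fun j => ofBits 11 (Split2.cols j)) ?_ ?_
    Split2.symbolicDet_one_ne_zero u w hu hw ?_ ?_
  · -- injectivity of the row table through `ofBits`
    intro i i' hii
    have hii' : ofBits 11 (Split2.rows i) = ofBits 11 (Split2.rows i') := hii
    have this : DecFamily.enc (((ofBits 11 (Split2.rows i)).map ι).image Fin.val) = DecFamily.enc (((ofBits 11 (Split2.rows i')).map ι).image Fin.val) := by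
      rw [hii']
    rw [enc_image_val_map_ofBits hh (by rw [Split2.rows_eq]; omega), enc_image_val_map_ofBits hh (by rw [Split2.rows_eq]; omega),
      Split2.rows_eq, Split2.rows_eq] at this
    exact Fin.ext this
  · intro j j' hjj
    have hjj' : ofBits 11 (Split2.cols j) = ofBits 11 (Split2.cols j') := hjj
    have this : DecFamily.enc (((ofBits 11 (Split2.cols j)).map ι).image Fin.val) = DecFamily.enc (((ofBits 11 (Split2.cols j')).map ι).image Fin.val) := by
      rw [hjj']
    rw [enc_image_val_map_ofBits hh (Split2.cols_shape j).1, enc_image_val_map_ofBits hh (Split2.cols_shape j').1] at this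
    exact Split2.cols_injective j j' this
  · -- rows: SplitRow 2 h = lifts of the row table
    ext U
    rw [hU, Set.mem_range]
    constructor
    · intro hrow
      have hU6 : ∀ y ∈ U, y.val < 6 := fun y hy => by have := hrow y hy; omega
      have hcode : DecFamily.enc (U.image Fin.val) < 64 := by have := enc_image_val_lt U hU6; simpa using this
      refine ⟨⟨DecFamily.enc (U.image Fin.val), hcode⟩, ?_⟩
      show (ofBits 11 (Split2.rows ⟨DecFamily.enc (U.image Fin.val), hcode⟩)).map ι = U
      rw [Split2.rows_eq]
      exact (eq_map_ofBits_enc hh U (fun y hy => by have := hU6 y hy; omega)).symm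
    · rintro ⟨i, rfl⟩ y hy
      have := ((mem_map_ofBits_iff hh _ y).mp hy).2
      rw [Split2.rows_eq] at this
      have hy6 : y.val < 6 := by
        by_contra hge
        have hlt : i.val < 2 ^ y.val := lt_of_lt_of_le i.isLt (le_trans (by norm_num) (Nat.pow_le_pow_right (by norm_num) (not_lt.mp hge)))
        rw [Nat.testBit_lt_two_pow hlt] at this
        exact Bool.false_ne_true this
      omega
  · -- columns: SplitCol 2 h = lifts of the column table
    ext W
    rw [hW, Set.mem_range]
    constructor
    · rintro ⟨hbd, hcard, hind⟩
      have hW11 : ∀ y ∈ W, y.val < 11 := fun y hy => by have := hbd y hy; omega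
      have hcode : DecFamily.enc (W.image Fin.val) < 2048 := by have := enc_image_val_lt W hW11; simpa using this
      have hWeq := eq_map_ofBits_enc hh W hW11
      obtain ⟨j, hj⟩ := Split2.cols_complete ⟨_, hcode⟩ (by
          simp only []
          have : (ofBits 11 (DecFamily.enc (W.image Fin.val))).card = W.card := by
            conv_rhs => rw [hWeq]
            rw [Finset.card_map]
          rw [this]; exact hcard)
        (by
          simp only []
          intro v v' hv hv' h8 h8'
          have hy := hind (ι v) (by rw [hWeq]; exact (mem_map_ofBits_iff hh _ _).mpr ⟨by simp [hι], by simpa [hι] using hv⟩)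
            (ι v') (by rw [hWeq]; exact (mem_map_ofBits_iff hh _ _).mpr ⟨by simp [hι], by simpa [hι] using hv'⟩)
            (by simpa [hι] using h8) (by simpa [hι] using h8')
          exact ι.injective hy)
      refine ⟨j, ?_⟩
      show (ofBits _ (_)).map ι = W
      rw [hj]; exact hWeq.symm
    · rintro ⟨j, rfl⟩
      obtain ⟨hlt, hcard, hind⟩ := Split2.cols_shape j
      refine ⟨fun y hy => ?_, by rw [Finset.card_map]; exact hcard, fun y hy y' hy' h8 h8' => ?_⟩
      · have := ((mem_map_ofBits_iff hh _ y).mp hy).1; omega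
      · obtain ⟨hy11, hyb⟩ := (mem_map_ofBits_iff hh _ y).mp hy
        obtain ⟨hy11', hyb'⟩ := (mem_map_ofBits_iff hh _ y').mp hy'
        have := hind ⟨y.val, hy11⟩ ⟨y'.val, hy11'⟩ hyb hyb' h8 h8'
        exact Fin.ext (by simpa using Fin.ext_iff.mp this)

/-! ## 3. `m = 1`: the bitmask tables of `Split1` -/

/-- The row table of `Split1` is the identity. -/
theorem Split1.rows_eq : ∀ i : Fin 16, Split1.rows i = i.val := by decide

/-- Every column bitmask of `Split1` has at most two bits, all `< 5`, at most one of them `≥ 4`. -/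
theorem Split1.cols_shape : ∀ j : Fin 16, Split1.cols j < 2 ^ 5 ∧ (ofBits 5 (Split1.cols j)).card ≤ 2 ∧
    (∀ v v' : Fin 5, (Split1.cols j).testBit v.val = true → (Split1.cols j).testBit v'.val = true → 4 ≤ v.val → 4 ≤ v'.val → v = v') := by
  decide

/-- Completeness of the column table of `Split1`. -/
theorem Split1.cols_complete : ∀ c : Fin 32, (ofBits 5 c.val).card ≤ 2 →
    (∀ v v' : Fin 5, c.val.testBit v.val = true → c.val.testBit v'.val = true → 4 ≤ v.val → 4 ≤ v'.val → v = v') →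
    ∃ j : Fin 16, Split1.cols j = c.val := by
  decide +kernel

/-- The column table of `Split1` is injective. -/
theorem Split1.cols_injective : ∀ j j' : Fin 16, Split1.cols j = Split1.cols j' → j = j' := by decide

/-- **SP at `m = 1`, lifted: every enumeration of `(SplitRow 1 h, SplitCol 1 h)`, `h ≥ 5`, has nonzero profile-1 symbolic minor.** -/
theorem splitFamily_one (h r : ℕ) (u w : Fin r → Finset (Fin h)) (hh : 5 ≤ h) (hu : Function.Injective u) (hw : Function.Injective w)
    (hU : ∀ U : Finset (Fin h), U ∈ Set.range u ↔ SplitRow 1 h U) (hW : ∀ W : Finset (Fin h), W ∈ Set.range w ↔ SplitCol 1 h W) :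
    symbolicDet 1 h r u w ≠ 0 := by
  set ι := Fin.castLEEmb hh with hι
  refine symbolicDet_ne_zero_lift ι (fun i => ofBits 5 (Split1.rows i)) (fun j => ofBits 5 (Split1.cols j)) ?_ ?_
    Split1.symbolicDet_one_ne_zero u w hu hw ?_ ?_
  · intro i i' hii
    have hii' : ofBits 5 (Split1.rows i) = ofBits 5 (Split1.rows i') := hii
    have this : DecFamily.enc (((ofBits 5 (Split1.rows i)).map ι).image Fin.val) = DecFamily.enc (((ofBits 5 (Split1.rows i')).map ι).image Fin.val) := by
      rw [hii']
    rw [enc_image_val_map_ofBits hh (by rw [Split1.rows_eq]; omega), enc_image_val_map_ofBits hh (by rw [Split1.rows_eq]; omega),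
      Split1.rows_eq, Split1.rows_eq] at this
    exact Fin.ext this
  · intro j j' hjj
    have hjj' : ofBits 5 (Split1.cols j) = ofBits 5 (Split1.cols j') := hjj
    have this : DecFamily.enc (((ofBits 5 (Split1.cols j)).map ι).image Fin.val) = DecFamily.enc (((ofBits 5 (Split1.cols j')).map ι).image Fin.val) := by
      rw [hjj']
    rw [enc_image_val_map_ofBits hh (Split1.cols_shape j).1, enc_image_val_map_ofBits hh (Split1.cols_shape j').1] at this
    exact Split1.cols_injective j j' this
  · ext U
    rw [hU, Set.mem_range]
    constructor
    · intro hrow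
      have hU4 : ∀ y ∈ U, y.val < 4 := fun y hy => by have := hrow y hy; omega
      have hcode : DecFamily.enc (U.image Fin.val) < 16 := by have := enc_image_val_lt U hU4; simpa using this
      refine ⟨⟨DecFamily.enc (U.image Fin.val), hcode⟩, ?_⟩
      show (ofBits 5 (Split1.rows ⟨DecFamily.enc (U.image Fin.val), hcode⟩)).map ι = U
      rw [Split1.rows_eq]
      exact (eq_map_ofBits_enc hh U (fun y hy => by have := hU4 y hy; omega)).symm
    · rintro ⟨i, rfl⟩ y hy
      have := ((mem_map_ofBits_iff hh _ y).mp hy).2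
      rw [Split1.rows_eq] at this
      have hy4 : y.val < 4 := by
        by_contra hge
        have hlt : i.val < 2 ^ y.val := lt_of_lt_of_le i.isLt (le_trans (by norm_num) (Nat.pow_le_pow_right (by norm_num) (not_lt.mp hge)))
        rw [Nat.testBit_lt_two_pow hlt] at this
        exact Bool.false_ne_true this
      omega
  · ext W
    rw [hW, Set.mem_range]
    constructor
    · rintro ⟨hbd, hcard, hind⟩
      have hW5 : ∀ y ∈ W, y.val < 5 := fun y hy => by have := hbd y hy; omega
      have hcode : DecFamily.enc (W.image Fin.val) < 32 := by have := enc_image_val_lt W hW5; simpa using this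
      have hWeq := eq_map_ofBits_enc hh W hW5
      obtain ⟨j, hj⟩ := Split1.cols_complete ⟨_, hcode⟩ (by
          simp only []
          have : (ofBits 5 (DecFamily.enc (W.image Fin.val))).card = W.card := by
            conv_rhs => rw [hWeq]
            rw [Finset.card_map]
          rw [this]; exact hcard)
        (by
          simp only []
          intro v v' hv hv' h4 h4'
          have hy := hind (ι v) (by rw [hWeq]; exact (mem_map_ofBits_iff hh _ _).mpr ⟨by simp [hι], by simpa [hι] using hv⟩)
            (ι v') (by rw [hWeq]; exact (mem_map_ofBits_iff hh _ _).mpr ⟨by simp [hι], by simpa [hι] using hv'⟩)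
            (by simpa [hι] using h4) (by simpa [hι] using h4')
          exact ι.injective hy)
      refine ⟨j, ?_⟩
      show (ofBits _ (_)).map ι = W
      rw [hj]; exact hWeq.symm
    · rintro ⟨j, rfl⟩
      obtain ⟨hlt, hcard, hind⟩ := Split1.cols_shape j
      refine ⟨fun y hy => ?_, by rw [Finset.card_map]; exact hcard, fun y hy y' hy' h4 h4' => ?_⟩
      · have := ((mem_map_ofBits_iff hh _ y).mp hy).1; omega
      · obtain ⟨hy5, hyb⟩ := (mem_map_ofBits_iff hh _ y).mp hy
        obtain ⟨hy5', hyb'⟩ := (mem_map_ofBits_iff hh _ y').mp hy'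
        have := hind ⟨y.val, hy5⟩ ⟨y'.val, hy5'⟩ hyb hyb' h4 h4'
        exact Fin.ext (by simpa using Fin.ext_iff.mp this)

/-! ## 4. SP for `m ≤ 2` -/

/-- **CONJECTURE SP HOLDS FOR `m ≤ 2`** — the registered stub `Stmt.stub_splitFamily` restricted to its first two levels (PARTIAL RANGE; `m ≥ 3` open). -/
theorem splitFamily_le_two : ∀ (m h r : ℕ) (u w : Fin r → Finset (Fin h)), 1 ≤ m → m ≤ 2 → 2 * m + 2 ≤ h → 2 ^ (m + 1) + 2 ^ m - 1 ≤ h →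
    Function.Injective u → Function.Injective w →
    (∀ U : Finset (Fin h), U ∈ Set.range u ↔ SplitRow m h U) → (∀ W : Finset (Fin h), W ∈ Set.range w ↔ SplitCol m h W) →
    symbolicDet 1 h r u w ≠ 0 := by
  intro m h r u w hm1 hm2 hh1 hh2 hu hw hU hW
  interval_cases m
  · exact splitFamily_one h r u w (by simpa using hh2) hu hw hU hW
  · exact splitFamily_two h r u w (by simpa using hh2) hu hw hU hW

end Summit.ValiantsHypothesis.ValiantsHypothesis.Theorems.BarrierLever.AnchoredPeeling
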